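import Summits.AtomisticToContinuum.Crystallization.Theorems.ChargedEnergyGapMaxCover
import Summits.AtomisticToContinuum.Crystallization.Theorems.ChargedEnergyGapShellBudget
import HarnessLib

/-!
# `ChargedEnergyGap` — the MAX-COVER weights as a core weight system and ★★ the re-based record cone (repair R1, typed and chained)
# (cell `decomp-a2c`, lens 3, generation 52, node «WeightLedger», part O-C; over parts N-B `…ChargedEnergyGapMaxCover` and O-D
# `…ChargedEnergyGapShellBudget`)

NOT OF RECORD until the census (C10 on the weights of record, C11 on the max cover) and the critic's row say so (row 1005 (c)).
The max-cover weights of part N-B (`ballWeightM`, `farWeightM`: far weight `(1 − max_x bump_x)⁴`, transition shell of full width `ϱ/2`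
around every core geometry) satisfy W1–W8 by the invariants proved there, so they form a `CoreWeights` (`maxCoverWeights`), and the
whole primed chain I-B′…N-A′ the critic asked for IS parts O-A/O-B instantiated at it: the leaves REG-BALL_M, LABEL_M, CB-FAR_M|cored are
`CoreBallRegularPricingW / CleanLabellingW / FarLabelledFloorCoredW (maxCoverWeights …)`, and ★★ the re-based record cone is
`chargedEnergyGap_of_weightLedger (maxCoverWeights …)`.  Also: LABEL_M ⟹ LABEL_G (the max-cover far weight is positive wherever the
far weight of record is, `farWeight ≤ farWeightM`), so the labelling leaf of the re-based cone is the (slightly) STRONGER one and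
the one of record follows from it.  The max-cover weights cover their shell (`coversShell_maxCover`), so the shell-budget dial
of part O-D applies verbatim: ★ CB-FAR_M|cored ⟺ CB-FAR_M|cored,(2ϱ/s+1)³ and ★★ the nine-leaf re-based cone with SHELL-BUDGET_M(10⁵).

TAGS.  REG-BALL_M: UNDECIDED · INSTRUMENTABLE · IDEA-NEEDED.  LABEL_M: TRUE-type · ATTACKABLE-M (implies LABEL_G).  CB-FAR_M|cored:
TRUE-leaning (transfer audit g51 §2: `≈ 10⁻²` per unit length of line core vs slack `0.17–0.36`; `≈ 1–3` per isolated compact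
cluster, which the shell budget of part O-D addresses) · ATTACKABLE-L · INSTRUMENTABLE (census C11, C8). -/

noncomputable section
open scoped Classical
open Literature.MathematicalPhysics.StatisticalMechanics
open Literature.Geometry.DiscreteGeometry
open Summit.AtomisticToContinuum.Crystallization.Theses.PricedLinkCensus
open Summit.AtomisticToContinuum.Crystallization.Theorems.ChargedEnergyGapNegative

namespace Summit.AtomisticToContinuum.Crystallization.Theorems.ChargedEnergyGapChartDial

section MaxCoverWeights

variable (θ ε R r η L δ L' ϱ : ℝ)

/-- The **MAX-COVER WEIGHTS** (part N-B) as a core weight system: W1–W8 are `ballWeightM_nonneg`, `farWeightM_nonneg`,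
`ballWeightM_sum_add_farWeightM`, `ballWeightM_of_not_isCore`, `farWeightM_eq_zero_of_isCore`, `lt_orbitDist_of_farWeightM_pos`,
`ballWeightM_add_period`, `farWeightM_add_period`. -/
def maxCoverWeights : CoreWeights θ ε R r η L δ L' ϱ where
  ball Q x q := ballWeightM θ ε R r η L δ L' ϱ Q x q
  far Q q := farWeightM θ ε R r η L δ L' ϱ Q q
  ball_nonneg Q x q := ballWeightM_nonneg Q x q
  far_nonneg Q q := farWeightM_nonneg Q q
  sum_ball_add_far Q q := ballWeightM_sum_add_farWeightM Q q
  ball_of_not_isCore _ _ hx q := ballWeightM_of_not_isCore hx q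
  far_of_isCore _ _ hy := farWeightM_eq_zero_of_isCore hy
  lt_orbitDist_of_far_pos hϱ _ _ hw _ hx := lt_orbitDist_of_farWeightM_pos hϱ hw hx
  ball_add_period Q x _ hg q := ballWeightM_add_period Q x hg q
  far_add_period Q _ hg q := farWeightM_add_period Q hg q

variable {θ ε R r η L δ L' ϱ} {c₁ s ρ₀ lam ℓ : ℝ}

/-- The far weight of the max-cover system is `farWeightM` (definitionally) … -/
theorem maxCoverWeights_far (Q : PeriodicConfiguration 3) (q : E3) :
    (maxCoverWeights θ ε R r η L δ L' ϱ).far Q q = farWeightM θ ε R r η L δ L' ϱ Q q := rfl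

/-- … and its ball weights are `ballWeightM`. -/
theorem maxCoverWeights_ball (Q : PeriodicConfiguration 3) (x : Q.motif) (q : E3) :
    (maxCoverWeights θ ε R r η L δ L' ϱ).ball Q x q = ballWeightM θ ε R r η L δ L' ϱ Q x q := rfl

/-- ★ LABEL_M ⟹ LABEL_G: the max-cover labelling leaf implies the labelling leaf of record (`farWeight ≤ farWeightM`). -/
theorem cleanLabellingG_of_maxCover (h : CleanLabellingW (maxCoverWeights θ ε R r η L δ L' ϱ) s ρ₀ lam ℓ) :
    CleanLabellingG θ ε R r η L δ L' ϱ s ρ₀ lam ℓ :=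
  fun Q hQ y hg hn hw => h Q hQ y hg hn (hw.trans_le (farWeight_le_farWeightM Q (y : E3)))

/-- The same in `W`-form: LABEL at `maxCoverWeights` ⟹ LABEL at `recordWeights`. -/
theorem cleanLabellingW_record_of_maxCover (h : CleanLabellingW (maxCoverWeights θ ε R r η L δ L' ϱ) s ρ₀ lam ℓ) :
    CleanLabellingW (recordWeights θ ε R r η L δ L' ϱ) s ρ₀ lam ℓ :=
  cleanLabellingW_record_iff.2 (cleanLabellingG_of_maxCover h)

/-- ★ The max-cover weights cover their shell (`0 < ϱ`): `farWeightM < 1 ⟹ coverMax > 0 ⟹` a positive core bump. -/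
theorem coversShell_maxCover (hϱ : 0 < ϱ) : CoversShell (maxCoverWeights θ ε R r η L δ L' ϱ) := by
  intro Q q hq
  change farWeightM θ ε R r η L δ L' ϱ Q q < 1 at hq
  have hM : coverMax θ ε R r η L δ L' ϱ Q q ≠ 0 := fun h0 => by
    rw [farWeightM_eq_one_of_coverMax_eq_zero h0] at hq
    exact lt_irrefl _ hq
  obtain ⟨x, hx⟩ := exists_coverMax_eq (θ := θ) (ε := ε) (R := R) (r := r) (η := η) (L := L) (δ := δ) (L' := L') (ϱ := ϱ) Q q
  have hpos : 0 < coreBump θ ε R r η L δ L' ϱ Q x q := by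
    rw [hx]; exact lt_of_le_of_ne (coverMax_nonneg Q q) (Ne.symm hM)
  obtain ⟨hcore, g, hg, hd⟩ := exists_core_near_of_coreBump_pos hϱ hpos
  exact ⟨x, hcore, g, hg, hd⟩

/-- The shell of the max cover in words: a motif site is in the transition shell iff `0 < farWeightM < 1`, i.e. (`0 < ϱ`) its distance
to the nearest incoherent core orbit lies strictly between `ϱ/2` and `ϱ` (W6 and `coversShell_maxCover` give the two inclusions used
by the ledger; the metric characterisation itself is not needed). -/
theorem inShell_maxCover_iff (Q : PeriodicConfiguration 3) (y : Q.motif) :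
    InShell (maxCoverWeights θ ε R r η L δ L' ϱ) Q y ↔
      0 < farWeightM θ ε R r η L δ L' ϱ Q (y : E3) ∧ farWeightM θ ε R r η L δ L' ϱ Q (y : E3) < 1 :=
  Iff.rfl

/-- ★ EQUIV at the packing end for the max cover: CB-FAR_M|cored ⟺ CB-FAR_M|cored,(2ϱ/s+1)³ (`0 < ϱ`, `0 < s`). -/
theorem farLabelledFloorCoredM_iff_budget_packing (hϱ : 0 < ϱ) (hs : 0 < s) :
    FarLabelledFloorCoredW (maxCoverWeights θ ε R r η L δ L' ϱ) c₁ s ρ₀ lam ℓ ↔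
      FarLabelledFloorCoredBudgetW (maxCoverWeights θ ε R r η L δ L' ϱ) c₁ s ρ₀ lam ℓ ((2 * ϱ / s + 1) ^ 3) :=
  farLabelledFloorCoredW_iff_budget_packing (coversShell_maxCover hϱ) hs hϱ.le

end MaxCoverWeights

/-! ## The re-based record cones (repair R1) -/

section Record

/-- ★★ **THE RE-BASED RECORD CONE** (repair R1 of memo g51, typed and chained; NOT of record pending census C10/C11): eight named
leaves `ChargeRecount · IP_G · FCP_G · CCP_G · REG-BALL_M · LABEL_M · CB-FAR_M|cored · P_G ⟹ ChargedEnergyGap` at the record dials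
`(3/20, 1/10, 6/5, 10, 1/100, 40, 1/10, 40, ϱ = 160, 1/20, 3/5, 10, 1/3, 3)` — the generic cone of part O-B at `maxCoverWeights`. -/
theorem chargedEnergyGap_of_maxCoverLedger_record (hF : ChargeRecount)
    (hIP : ImprovablePricingG (3 / 20) (1 / 10) (6 / 5) 10 (1 / 100) (3 / 5))
    (hFCP : FrustratedCorePricingG (3 / 20) (1 / 10) (6 / 5) 10 (1 / 100) 40 (3 / 5))
    (hCCP : CoherentCorePricingG (3 / 20) (1 / 10) (6 / 5) 10 (1 / 100) 40 (1 / 10) 40 (3 / 5))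
    (hB : CoreBallRegularPricingW (maxCoverWeights (3 / 20) (1 / 10) (6 / 5) 10 (1 / 100) 40 (1 / 10) 40 160) (1 / 20) (3 / 5) 10
      fun _ _ => True)
    (hLab : CleanLabellingW (maxCoverWeights (3 / 20) (1 / 10) (6 / 5) 10 (1 / 100) 40 (1 / 10) 40 160) (3 / 5) 10 (1 / 3) 3)
    (hCB : FarLabelledFloorCoredW (maxCoverWeights (3 / 20) (1 / 10) (6 / 5) 10 (1 / 100) 40 (1 / 10) 40 160) (1 / 20) (3 / 5) 10 (1 / 3) 3)
    (hP : ChartedChargePricingG (3 / 20) (1 / 10) (3 / 5)) : ChargedEnergyGap :=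
  chargedEnergyGap_of_weightLedger _ hF hIP hFCP hCCP hB hLab hCB hP

/-- ★★ **THE RE-BASED NINE-LEAF CONE** with the shell-budget split of part O-D: `ChargeRecount · IP_G · FCP_G · CCP_G · REG-BALL_M ·
LABEL_M · SHELL-BUDGET_M(10⁵) · CB-FAR_M|cored,10⁵ · P_G ⟹ ChargedEnergyGap` at the record dials, `ϱ = 160`. -/
theorem chargedEnergyGap_of_maxCoverBudgetLedger_record (hF : ChargeRecount)
    (hIP : ImprovablePricingG (3 / 20) (1 / 10) (6 / 5) 10 (1 / 100) (3 / 5))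
    (hFCP : FrustratedCorePricingG (3 / 20) (1 / 10) (6 / 5) 10 (1 / 100) 40 (3 / 5))
    (hCCP : CoherentCorePricingG (3 / 20) (1 / 10) (6 / 5) 10 (1 / 100) 40 (1 / 10) 40 (3 / 5))
    (hB : CoreBallRegularPricingW (maxCoverWeights (3 / 20) (1 / 10) (6 / 5) 10 (1 / 100) 40 (1 / 10) 40 160) (1 / 20) (3 / 5) 10
      fun _ _ => True)
    (hLab : CleanLabellingW (maxCoverWeights (3 / 20) (1 / 10) (6 / 5) 10 (1 / 100) 40 (1 / 10) 40 160) (3 / 5) 10 (1 / 3) 3)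
    (hSB : ShellBudgetW (maxCoverWeights (3 / 20) (1 / 10) (6 / 5) 10 (1 / 100) 40 (1 / 10) 40 160) (3 / 5) 100000)
    (hCB : FarLabelledFloorCoredBudgetW (maxCoverWeights (3 / 20) (1 / 10) (6 / 5) 10 (1 / 100) 40 (1 / 10) 40 160) (1 / 20) (3 / 5) 10
      (1 / 3) 3 100000)
    (hP : ChartedChargePricingG (3 / 20) (1 / 10) (3 / 5)) : ChargedEnergyGap :=
  chargedEnergyGap_of_budgetLedger _ hF hIP hFCP hCCP hB hLab hSB hCB hP

end Record

end Summit.AtomisticToContinuum.Crystallization.Theorems.ChargedEnergyGapChartDial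

end
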